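import Mathlib
import Literature.Combinatorics.Enumerative.AntidiagonalTupleCard
import Literature.NumberTheory.DiophantineApproximation.SiegelLemmaMargin
import Literature.RingTheory.MvPowerSeries.ProductFamilyIndependence
import Literature.Analysis.Asymptotics.HolonomyBoundLimits
import HarnessLib

/-!
# The auxiliary function of Calegari–Dimitrov–Tang's Lemma 2.1.1 (Siegel-lemma construction)

`Literature/NumberTheory/DiophantineApproximation/SeparatedVariablesAuxiliary.lean`. Everything
here is PROVED (no definition, no named fact). We formalize the auxiliary construction
(Lemma 2.1.1) of F. Calegari, V. Dimitrov, Y. Tang, *The unbounded denominators conjecture*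
(J. Amer. Math. Soc. **38** (2025), 627–702; arXiv:2109.09040), §2.1, in its arithmetic core.

**The printed statement.** "Let `d, α ∈ ℕ_{>0}` and `κ ∈ (0,1)` be parameters. Asymptotically in
`α → ∞` as `d` and `κ` are held fixed, there exists a *nonzero* `d`-variate formal function `F(x)`
of the form (2.5) `F(x) = ∑_{i ∈ {1,…,m}^d, k ∈ {0,…,D−1}^d} a_{i,k} p(x)^k ∏_{s=1}^d f_{i_s}(x_s)
∈ ℚ⟦x⟧ ∖ {0}`, vanishing to order at least `α` at `x = 0`, with (1)
`D ≤ (1/(d!)^{1/d}) (1/m) (1 + 1/κ)^{1/d} α + o(α)`; (2) all `a_{i,k} ∈ ℤ` are integers bounded in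
absolute value by `exp(κ C α + o(α))` for some constant `C ∈ ℝ` depending only on the radius `ρ`
from (2.3) and on the degree and height of the rational function `p(x) ∈ ℚ(x)`."

**The printed proof** reduces, via `x(t) ∈ t + (t²/M)ℤ⟦t/M⟧` and the inverse series, to the
situation `p(x), f_i(x) ∈ ℤ⟦x/M⟧` convergent on `|x| < ρ`, and concludes: "The result then
follows from the classical Siegel lemma [BombieriGubler, Lemma 2.9.1], with `e^C := M/ρ` and the
degree parameter choice `D ∼ (1/(m (d!)^{1/d}))(1 + 1/κ)^{1/d} α`, that brings in a Dirichlet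
exponent `∼ κ` as `α → ∞`", the nonvanishing of `F` coming from the `ℚ(p(x))`-linear independence
of the products `∏_s f_{i_s}(x_s)` "since at least one `a_{i,j} ≠ 0`".

**What is formalized here** is exactly this Siegel-lemma step, for the *rescaled integer data*
`P(x) := p(Mx)`-type series: given `P ∈ ℤ⟦x⟧` and `f₁, …, f_m ∈ ℤ⟦x⟧` with the geometric
coefficient bounds `|[xⁿ] Pᵏ| ≤ Rⁿ` (all `k`; this is `sup_{|x| ≤ 1/R} |P| ≤ 1` by Cauchy) and
`|[xⁿ] f_i| ≤ B Rⁿ` (`R = M/ρ ≥ 1`, `B ≥ 1`), and parameters `d ≥ 1`, `κ > 0`, `α ≥ 1`: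

* `exists_auxiliary_coefficients` — there are `D ≥ 1` with
  `D ≤ (1 + 1/κ)^{1/d} (d!)^{−1/d} (α + d)/m + 1` (item (1) with an explicit `o(α)`) and integers
  `a_{i,k}`, not all zero, such that `F := ∑ a_{i,k} ∏_s (P^{k_s} f_{i_s})(x_s)` has all
  coefficients of degree `< α` equal to zero (the `C(α+d−1, d)` linear equations, counted by
  `Literature.Combinatorics.Enumerative.card_sigma_range_antidiagonalTuple`, in the `(mD)^d`
  unknowns, solved by Siegel's lemma with Dirichlet exponent `≤ κ`,
  `Literature.NumberTheory.DiophantineApproximation.exists_ne_zero_int_vec_log_norm_le`), and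
  `|a_{i,k}| ≤ exp(κ (α log R + d log(mD) + d log(αB)))` (item (2): `C = log R = log(M/ρ)`, the
  other two terms being `o(α)`);
* `sum_smul_prod_ne_zero` — "`F ≢ 0` since at least one `a_{i,k} ≠ 0`", from the independence of
  the products (`Literature.RingTheory.MvPowerSeries.productFamily_independent_fin`).

The reduction of CDT's analytic hypotheses to these coefficient bounds (inverse function theorem,
Cauchy's estimate) and of the integrality hypothesis `p(x(t)), f_i(x(t)) ∈ ℤ⟦t⟧` to
`p, f_i ∈ ℤ⟦x/M⟧` (`Literature.RingTheory.PowerSeries.rescale_mem_range_of_subst_mem_range`) is not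
repeated here.

## References

* [CalegariDimitrovTang2025] F. Calegari, V. Dimitrov, Y. Tang, The unbounded denominators
  conjecture, J. Amer. Math. Soc. 38 (2025), no. 3, 627–702, §2.1, Lemma 2.1.1 and its proof;
  arXiv:2109.09040.
* E. Bombieri, W. Gubler, Heights in Diophantine geometry, CUP 2006, Lemma 2.9.1.
-/

noncomputable section

namespace Literature.NumberTheory.DiophantineApproximation

open Finset Real Literature.RingTheory.MvPowerSeries Literature.Combinatorics.Enumerative
open scoped Nat

/-! ### 1. Nonvanishing of the auxiliary function from the independence of the products -/

/-- **"`F ≢ 0` since at least one `a_{i,k} ≠ 0`"** (CDT, end of the proof of Lemma 2.1.1): if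
`f₁, …, f_m ∈ K⟦x⟧` admit no nontrivial `K[p]`-linear relation (i.e. are `K(p(x))`-linearly
independent), then for coefficients `a_{i,k}` not all zero the separated-variables combination
`∑_{i,k} a_{i,k} ∏_s (p^{k_s} f_{i_s})(x_s) ∈ K⟦x₁, …, x_d⟧` is nonzero.
[cite: CalegariDimitrovTang2025, §2.1, end of the proof of Lemma 2.1.1] -/
theorem sum_smul_prod_ne_zero {K : Type*} [Field K] {m d D : ℕ} (f : Fin m → PowerSeries K)
    (p : PowerSeries K)
    (hind : ∀ Q : Fin m → Polynomial K, ∑ i, Polynomial.aeval p (Q i) * f i = 0 → ∀ i, Q i = 0)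
    {a : (Fin d → Fin m) × (Fin d → Fin D) → K} (ha : a ≠ 0) :
    ∑ J, a J • ∏ s, ((p ^ (J.2 s : ℕ) * f (J.1 s)).toMvPowerSeries s : MvPowerSeries (Fin d) K)
      ≠ 0 := by
  classical
  intro hF
  apply ha
  -- exponent vectors as finitely supported functions
  set kfin : (Fin d → Fin D) → (Fin d →₀ ℕ) :=
    fun k ↦ Finsupp.equivFunOnFinite.symm (fun s ↦ (k s : ℕ)) with hkfin
  have hkfin_apply : ∀ k s, kfin k s = (k s : ℕ) := fun k s ↦ by simp [hkfin]
  have hkinj : Function.Injective kfin := by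
    intro k k' h
    funext s
    apply Fin.ext
    have h1 := congrArg (fun e : Fin d →₀ ℕ ↦ e s) h
    simpa only [hkfin_apply] using h1
  -- the polynomials `Q_i := ∑_k a_{i,k} X^k ∈ K[X₁, …, X_d]`
  set Q : (Fin d → Fin m) → MvPolynomial (Fin d) K :=
    fun I ↦ ∑ k : Fin d → Fin D, a (I, k) • MvPolynomial.monomial (kfin k) 1 with hQ
  have haeval : ∀ I, MvPolynomial.aeval
      (fun s : Fin d ↦ (p.toMvPowerSeries s : MvPowerSeries (Fin d) K)) (Q I) =
      ∑ k : Fin d → Fin D, a (I, k) •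
        ∏ s, ((p ^ (k s : ℕ)).toMvPowerSeries s : MvPowerSeries (Fin d) K) := by
    intro I
    rw [hQ]
    dsimp only
    rw [map_sum]
    refine sum_congr rfl fun k _ ↦ ?_
    rw [map_smul, MvPolynomial.aeval_monomial, map_one, one_mul,
      Finsupp.prod_fintype _ _ (fun s ↦ pow_zero _)]
    simp_rw [hkfin_apply, map_pow]
  -- `F = ∑_i Q_i((p(x_s))_s) ∏_s f_{i_s}(x_s)`
  have hrel : ∑ I : Fin d → Fin m, MvPolynomial.aeval
      (fun s : Fin d ↦ (p.toMvPowerSeries s : MvPowerSeries (Fin d) K)) (Q I) *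
        ∏ s, ((f (I s)).toMvPowerSeries s : MvPowerSeries (Fin d) K) = 0 := by
    rw [← hF, Fintype.sum_prod_type]
    refine sum_congr rfl fun I _ ↦ ?_
    rw [haeval, sum_mul]
    refine sum_congr rfl fun k _ ↦ ?_
    rw [smul_mul_assoc, ← prod_mul_distrib]
    refine congrArg (a (I, k) • ·) (prod_congr rfl fun s _ ↦ ?_)
    rw [map_mul]
  have hQ0 := productFamily_independent_fin f p hind d Q hrel
  funext ⟨I, k⟩
  have h := congrArg (MvPolynomial.coeff (kfin k)) (hQ0 I)
  rw [MvPolynomial.coeff_zero, hQ] at h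
  dsimp only at h
  rw [MvPolynomial.coeff_sum] at h
  simp_rw [MvPolynomial.coeff_smul, MvPolynomial.coeff_monomial, smul_eq_mul, mul_ite, mul_one,
    mul_zero] at h
  rw [Finset.sum_eq_single k (fun k' _ hk' ↦ if_neg fun h' ↦ hk' (hkinj h'))
    (fun h' ↦ absurd (mem_univ k) h'), if_pos rfl] at h
  exact h

/-! ### 2. The entries of the linear system and their size -/

/-- Coefficients of `Pᵏ f` under geometric bounds: if `|[xⁿ] Pᵏ| ≤ Rⁿ` and `|[xⁿ] f| ≤ B Rⁿ`
for all `n`, then `|[xⁿ](Pᵏ f)| ≤ (n + 1) B Rⁿ`. [folklore] -/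
theorem abs_coeff_pow_mul_le {P f : PowerSeries ℤ} {R B : ℝ} {k : ℕ}
    (hP : ∀ n, |((PowerSeries.coeff n (P ^ k) : ℤ) : ℝ)| ≤ R ^ n)
    (hf : ∀ n, |((PowerSeries.coeff n f : ℤ) : ℝ)| ≤ B * R ^ n) (n : ℕ) :
    |((PowerSeries.coeff n (P ^ k * f) : ℤ) : ℝ)| ≤ (n + 1) * B * R ^ n := by
  rw [PowerSeries.coeff_mul, Int.cast_sum]
  refine (abs_sum_le_sum_abs _ _).trans ?_
  have hterm : ∀ q ∈ antidiagonal n,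
      |((PowerSeries.coeff q.1 (P ^ k) * PowerSeries.coeff q.2 f : ℤ) : ℝ)| ≤ B * R ^ n := by
    intro q hq
    rw [HasAntidiagonal.mem_antidiagonal] at hq
    rw [Int.cast_mul, abs_mul]
    have h1 := hP q.1
    have h2 := hf q.2
    have hR1 : 0 ≤ R ^ q.1 := le_trans (abs_nonneg _) h1
    calc |((PowerSeries.coeff q.1 (P ^ k) : ℤ) : ℝ)| * |((PowerSeries.coeff q.2 f : ℤ) : ℝ)|
        ≤ R ^ q.1 * (B * R ^ q.2) :=
          mul_le_mul h1 h2 (abs_nonneg _) hR1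
      _ = B * R ^ n := by rw [← hq, pow_add]; ring
  calc ∑ q ∈ antidiagonal n, |((PowerSeries.coeff q.1 (P ^ k) * PowerSeries.coeff q.2 f : ℤ) : ℝ)|
      ≤ ∑ q ∈ antidiagonal n, B * R ^ n := sum_le_sum hterm
    _ = (n + 1) * B * R ^ n := by
        rw [sum_const, Finset.Nat.card_antidiagonal, nsmul_eq_mul]
        push_cast
        ring

/-- **Size of the entries of CDT's linear system**: for a multi-index `e` with `|e| < α` in `d`
variables, `|∏_s [x^{e_s}](P^{k_s} f_{i_s})| ≤ (αB)^d R^α` (`R, B ≥ 1`).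
[cite: CalegariDimitrovTang2025, §2.1, proof of Lemma 2.1.1] -/
theorem abs_prod_coeff_le {m d : ℕ} (P : PowerSeries ℤ) (f : Fin m → PowerSeries ℤ) {R B : ℝ}
    (hR : 1 ≤ R) (hB : 1 ≤ B)
    (hP : ∀ k n : ℕ, |((PowerSeries.coeff n (P ^ k) : ℤ) : ℝ)| ≤ R ^ n)
    (hf : ∀ i n, |((PowerSeries.coeff n (f i) : ℤ) : ℝ)| ≤ B * R ^ n)
    {α : ℕ} (e : Fin d → ℕ) (he : ∑ s, e s < α) (i : Fin d → Fin m) (k : Fin d → ℕ) :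
    |((∏ s, PowerSeries.coeff (e s) (P ^ k s * f (i s)) : ℤ) : ℝ)| ≤
      ((α : ℝ) * B) ^ d * R ^ α := by
  rw [Int.cast_prod, abs_prod]
  have hes : ∀ s, e s + 1 ≤ α := fun s ↦
    lt_of_le_of_lt (Finset.single_le_sum (fun t _ ↦ Nat.zero_le (e t)) (mem_univ s)) he
  have hterm : ∀ s, |((PowerSeries.coeff (e s) (P ^ k s * f (i s)) : ℤ) : ℝ)| ≤
      (α : ℝ) * B * R ^ e s := by
    intro s
    refine (abs_coeff_pow_mul_le (hP (k s)) (hf (i s)) (e s)).trans ?_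
    have h1 : ((e s : ℕ) : ℝ) + 1 ≤ α := by exact_mod_cast hes s
    have hB0 : 0 ≤ B := zero_le_one.trans hB
    have hR0 : 0 ≤ R ^ e s := pow_nonneg (zero_le_one.trans hR) _
    gcongr
  calc ∏ s, |((PowerSeries.coeff (e s) (P ^ k s * f (i s)) : ℤ) : ℝ)|
      ≤ ∏ s, (α : ℝ) * B * R ^ e s := prod_le_prod (fun s _ ↦ abs_nonneg _) fun s _ ↦ hterm s
    _ = ((α : ℝ) * B) ^ d * R ^ (∑ s, e s) := by
        rw [prod_mul_distrib, prod_const, card_univ, Fintype.card_fin, prod_pow_eq_pow_sum]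
    _ ≤ ((α : ℝ) * B) ^ d * R ^ α := by
        have hαB : 0 ≤ ((α : ℝ) * B) ^ d := by positivity
        exact mul_le_mul_of_nonneg_left (pow_le_pow_right₀ hR he.le) hαB

/-! ### 3. Lemma 2.1.1: the Siegel-lemma construction -/

/-- **CDT Lemma 2.1.1 (auxiliary construction), arithmetic core.** Let `P ∈ ℤ⟦x⟧` and
`f₁, …, f_m ∈ ℤ⟦x⟧` (`m ≥ 1`) satisfy `|[xⁿ] Pᵏ| ≤ Rⁿ` for all `k, n` and `|[xⁿ] f_i| ≤ B Rⁿ`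
(`R, B ≥ 1`), and let `d ≥ 1`, `κ > 0`, `α ≥ 1`. Then there exist `D ≥ 1` with
`D ≤ (1 + 1/κ)^{1/d} (d!)^{−1/d} (α + d)/m + 1` and integers `a_{i,k}`
(`i ∈ {1,…,m}^d`, `k ∈ {0,…,D−1}^d`), not all zero, such that
`F(x) = ∑_{i,k} a_{i,k} ∏_s P(x_s)^{k_s} f_{i_s}(x_s)` vanishes to order `≥ α` at `x = 0` — every
coefficient `[xᵉ] F = ∑_{i,k} a_{i,k} ∏_s [x^{e_s}](P^{k_s} f_{i_s})` with `|e| < α` is zero —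
and `|a_{i,k}| ≤ exp(κ (α log R + d log(mD) + d log(αB)))`: Siegel's lemma for the
`C(α+d−1, d)` equations in the `(mD)^d` unknowns, whose integer entries are bounded by
`(αB)^d R^α`, with Dirichlet exponent `≤ κ`. (In CDT's notation `R = M/ρ = e^C`; the printed
`κ C α + o(α)` is made explicit.) [cite: CalegariDimitrovTang2025, Lemma 2.1.1] -/
theorem exists_auxiliary_coefficients {m d : ℕ} (hm : 0 < m) (hd : 0 < d)
    (P : PowerSeries ℤ) (f : Fin m → PowerSeries ℤ) {R B : ℝ} (hR : 1 ≤ R) (hB : 1 ≤ B)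
    (hP : ∀ k n : ℕ, |((PowerSeries.coeff n (P ^ k) : ℤ) : ℝ)| ≤ R ^ n)
    (hf : ∀ i n, |((PowerSeries.coeff n (f i) : ℤ) : ℝ)| ≤ B * R ^ n)
    {κ : ℝ} (hκ : 0 < κ) {α : ℕ} (hα : 0 < α) :
    ∃ D : ℕ, 0 < D ∧
      (D : ℝ) ≤ (1 + κ⁻¹) ^ (d : ℝ)⁻¹ / ((d ! : ℝ) ^ (d : ℝ)⁻¹ * m) * (α + d) + 1 ∧
      ∃ a : (Fin d → Fin m) × (Fin d → Fin D) → ℤ, a ≠ 0 ∧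
        (∀ e : Fin d →₀ ℕ, e.degree < α →
          ∑ J, a J * ∏ s, PowerSeries.coeff (e s) (P ^ (J.2 s : ℕ) * f (J.1 s)) = 0) ∧
        ∀ J, |(a J : ℝ)| ≤
          Real.exp (κ * (α * Real.log R + d * Real.log (m * D) + d * Real.log (α * B))) := by
  classical
  obtain ⟨k, rfl⟩ : ∃ k, d = k + 1 := ⟨d - 1, by omega⟩
  obtain ⟨D, hD0, hDcard, hDle⟩ :=
    Literature.Analysis.Asymptotics.exists_degree_param hm hd hα hκ
  refine ⟨D, hD0, hDle, ?_⟩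
  -- the rows: multi-indices of degree `< α`
  set S : Finset (Σ _ : ℕ, Fin (k + 1) → ℕ) :=
    (range α).sigma fun n ↦ Finset.Nat.antidiagonalTuple (k + 1) n with hS
  -- the integer matrix of the linear system
  set A : Matrix S ((Fin (k + 1) → Fin m) × (Fin (k + 1) → Fin D)) ℤ :=
    Matrix.of fun r J ↦ ∏ s, PowerSeries.coeff (r.1.2 s) (P ^ (J.2 s : ℕ) * f (J.1 s)) with hA
  -- counting rows and columns
  have hcardS : Fintype.card S = (α + k).choose (k + 1) := by
    rw [Fintype.card_coe, hS, card_sigma_range_antidiagonalTuple]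
  have hcardβ : Fintype.card ((Fin (k + 1) → Fin m) × (Fin (k + 1) → Fin D)) =
      m ^ (k + 1) * D ^ (k + 1) := by
    simp only [Fintype.card_prod, Fintype.card_fun, Fintype.card_fin]
  have hrows : 0 < Fintype.card S := by
    rw [hcardS]
    exact Nat.choose_pos (by omega)
  have hmn : (1 + κ⁻¹) * (Fintype.card S : ℝ) ≤
      Fintype.card ((Fin (k + 1) → Fin m) × (Fin (k + 1) → Fin D)) := by
    rw [hcardS, hcardβ]
    have hk1 : α + (k + 1) - 1 = α + k := by omega
    rw [hk1] at hDcard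
    calc (1 + κ⁻¹) * (((α + k).choose (k + 1) : ℕ) : ℝ) ≤ ((m * D : ℕ) : ℝ) ^ (k + 1) := hDcard
      _ = ((m ^ (k + 1) * D ^ (k + 1) : ℕ) : ℝ) := by push_cast; ring
  obtain ⟨t, ht0, hAt, hlog⟩ := exists_ne_zero_int_vec_log_norm_le A hκ hrows hmn
  refine ⟨t, ht0, ?_, ?_⟩
  · -- the equations: vanishing of the coefficients of degree `< α`
    intro e he
    have hmem : (⟨e.degree, ⇑e⟩ : Σ _ : ℕ, Fin (k + 1) → ℕ) ∈ S := by
      rw [hS, mem_sigma_range_antidiagonalTuple]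
      exact ⟨he, (Finsupp.degree_eq_sum e).symm⟩
    have h := congrFun hAt ⟨_, hmem⟩
    simp only [Matrix.mulVec, dotProduct, Pi.zero_apply, hA, Matrix.of_apply] at h
    rw [← h]
    exact sum_congr rfl fun J _ ↦ mul_comm _ _
  · -- the height bound
    intro J
    set T : ℝ := α * Real.log R + (k + 1 : ℕ) * Real.log (α * B) with hT
    have hR0 : 0 < R := zero_lt_one.trans_le hR
    have hB0 : 0 < B := zero_lt_one.trans_le hB
    have hα0 : (0 : ℝ) < α := by exact_mod_cast hα
    have hT0 : 0 ≤ T := by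
      rw [hT]
      have h1 : 0 ≤ Real.log R := Real.log_nonneg hR
      have h2 : 0 ≤ Real.log (α * B) :=
        Real.log_nonneg (one_le_mul_of_one_le_of_one_le (by exact_mod_cast hα) hB)
      positivity
    -- entries are bounded by `exp T = (αB)^d R^α`
    have hexpT : Real.exp T = ((α : ℝ) * B) ^ (k + 1) * R ^ α := by
      rw [hT, Real.exp_add, Real.exp_nat_mul, Real.exp_nat_mul, Real.exp_log hR0,
        Real.exp_log (by positivity), mul_comm]
    have hentry : ∀ r : S, ∀ J', |(A r J' : ℝ)| ≤ Real.exp T := by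
      intro r J'
      rw [hexpT, hA, Matrix.of_apply]
      have hr : ∑ s, r.1.2 s < α := by
        have hr' : (r : Σ _ : ℕ, Fin (k + 1) → ℕ) ∈
            (range α).sigma fun n ↦ Finset.Nat.antidiagonalTuple (k + 1) n := by
          rw [← hS]; exact r.2
        rw [mem_sigma_range_antidiagonalTuple] at hr'
        rw [hr'.2]
        exact hr'.1
      exact abs_prod_coeff_le P f hR hB hP hf r.1.2 hr J'.1 (fun s ↦ (J'.2 s : ℕ))
    have hnormA : ‖Matrix.of.symm A‖ ≤ Real.exp T := by
      refine (pi_norm_le_iff_of_nonneg (Real.exp_pos T).le).mpr fun r ↦ ?_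
      refine (pi_norm_le_iff_of_nonneg (Real.exp_pos T).le).mpr fun J' ↦ ?_
      rw [Int.norm_eq_abs]
      exact hentry r J'
    have hposlog : log⁺ ‖Matrix.of.symm A‖ ≤ T := by
      calc log⁺ ‖Matrix.of.symm A‖ ≤ log⁺ (Real.exp T) :=
            Real.posLog_le_posLog (norm_nonneg _) hnormA
        _ = T := by
            rw [Real.posLog_eq_log (by rw [Real.abs_exp]; exact Real.one_le_exp hT0),
              Real.log_exp]
    have hcardlog : Real.log (Fintype.card ((Fin (k + 1) → Fin m) × (Fin (k + 1) → Fin D)) : ℝ)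
        = (k + 1 : ℕ) * Real.log (m * D) := by
      rw [hcardβ]
      push_cast
      rw [← mul_pow, Real.log_pow]
      push_cast
      ring
    -- Siegel's bound, made explicit
    have h1 : κ * (Real.log (Fintype.card ((Fin (k + 1) → Fin m) × (Fin (k + 1) → Fin D)) : ℝ) +
        log⁺ ‖Matrix.of.symm A‖) ≤ κ * ((k + 1 : ℕ) * Real.log (m * D) + T) := by
      rw [hcardlog]
      exact mul_le_mul_of_nonneg_left (add_le_add (le_refl _) hposlog) hκ.le
    have heq : κ * ((k + 1 : ℕ) * Real.log (m * D) + T) =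
        κ * (α * Real.log R + (k + 1 : ℕ) * Real.log (m * D) + (k + 1 : ℕ) * Real.log (α * B)) := by
      rw [hT]; ring
    have hlog' : Real.log ‖t‖ ≤
        κ * (α * Real.log R + (k + 1 : ℕ) * Real.log (m * D) + (k + 1 : ℕ) * Real.log (α * B)) :=
      heq ▸ hlog.trans h1
    have htpos : 0 < ‖t‖ := norm_pos_iff.mpr ht0
    have htle : ‖t‖ ≤
        Real.exp (κ * (α * Real.log R + (k + 1 : ℕ) * Real.log (m * D) +
          (k + 1 : ℕ) * Real.log (α * B))) := (Real.log_le_iff_le_exp htpos).mp hlog'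
    calc |(t J : ℝ)| = ‖t J‖ := (Int.norm_eq_abs (t J)).symm
      _ ≤ ‖t‖ := norm_le_pi_norm t J
      _ ≤ _ := htle

end Literature.NumberTheory.DiophantineApproximation
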